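import Literature.AlgebraicGeometry.ShimuraVarieties.UnitaryCurveConeExtension
import Mathlib.Analysis.SpecialFunctions.Exponential
import Mathlib.Analysis.Calculus.InverseFunctionTheorem.FDeriv
import Mathlib.Analysis.Calculus.ContDiff.RCLike
import Mathlib.Analysis.Calculus.Deriv.Inv
import HarnessLib

/-!
# The cone chart at a point of `U(σ_{w₁}J)(ℂ)` (rank `2`): real differentiability on the cone-open from differentiability of the `𝔭`-probe

Topic `AlgebraicGeometry/ShimuraVarieties`; namespace `Literature.AlgebraicGeometry.ShimuraVarieties.UnitaryCurveCone`.  THEOREMS ONLY (no `def`,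
no instance, no notation, no named fact, no `sorry`); imports ★ `UnitaryCurveConeExtension` (frame basis, `Stab(ℂ v₀)` frame coordinates, `exp` into
`U = archLocal E 2 J w₁`, the `𝔭`-probe, the factorisation `Ω = U · Stab(ℂ v₀)` of the cone-open `Ω = {g | IsUnit g ∧ g v₀ ∈ negCone}`) and Mathlib's
inverse function theorem.  Second file of the rank-2 CONE DICTIONARY (sequel: `UnitaryCurveConeHolomorphyOfCR`).

SETTING as in ★ `UnitaryCurveConeExtension`: `Jw = σ_{w₁} J` hermitian, cone frame `𝔣 = (v₀, t₀)`, a function `Φ : M₂(ℂ) → ℂ` obeying the CONE LAW of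
★ `IsConeHol 𝔣` (`Φ (g b) = (a k⁻¹) Φ g` for `b v₀ = k v₀`, `b t₀ = a t₀ + d v₀`), a `𝔭`-probe `X : ℂ →ₗ[ℝ] M₂(ℂ)` (`X z ∈ 𝔲(Jw)`, `X z · v₀ = z t₀`,
`X z · t₀ ∈ ℂ v₀`), and `u ∈ U`.  `Φ` is read on `ℂ^{2×2} = Fin 2 → Fin 2 → ℂ` through `Matrix.of`, as in the holomorphy clause of ★ `IsConeHol`.

MAIN RESULTS.
* §1 `eq_of_mulVec_frame_eq`, `exists_matrix_of_frame_action`, `frame_coords_one_add_smul` — matrices are determined by, and can be prescribed on,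
  the frame.
* §2 `hasDerivAt_law_line` — along a line `ζ ↦ u (1 + ζ Y)`, `Y ∈ Stab(ℂ v₀)` with frame coordinates `(k, a, d)`, the cone law makes `Φ` the
  rational function `(1 + ζ a)(1 + ζ k)⁻¹ Φ(u)`, with complex derivative `(a − k) Φ(u)` at `0`; `fderiv_apply_smul_stab` — hence a real Fréchet
  differential `D` of `Φ` at `u` is `ℂ`-LINEAR on the real subspace `u · Stab(ℂ v₀)`: `D (ζ • u Y) = ζ (a − k) Φ(u)`.
* §3 **`differentiableAt_real_of_coneLaw_of_probe`** — if the probe `z ↦ Φ (u · exp (X z))` is real-differentiable at `0`, then `Φ` is real-Fréchet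
  differentiable at `u`: the CONE CHART `F(z, k, a, d) = u · exp(X z) · (1 + k P_v + a P_t + d N)` (`P_v, P_t, N` the frame matrices) is smooth with
  bijective differential at `0`, hence a local diffeomorphism (Mathlib `HasStrictFDerivAt.localInverse`), and `Φ ∘ F = (1 + a)(1 + k)⁻¹ Φ(u exp(X z))`
  by the cone law.
Borel (1997) §5.13–§5.14 is the printed dictionary «functions on the group with an automorphy factor ↔ functions on the symmetric space» for
`SL₂(ℝ)`; here it is carried out frame-free for an arbitrary signature-`(1,1)` hermitian form on the cone over the disc of negative lines
(Bergeron–Millson–Moeglin (2016) Part 2 §1.3).  Cell `hodgecm-mathlib`, floor 0, K-groundwork for the P5 named fact TP₂; seat A-p14 (g16).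
HC_CM is proved only modulo the printed citations until rung 0 closes; nothing printed is asserted here.

## References
* [Borel1997] A. Borel, *Automorphic forms on SL₂(ℝ)*, Cambridge Tracts in Math. 130 (1997), §5.13–§5.14.
* [BergeronMillsonMoeglin2016Balls] N. Bergeron, J. Millson, C. Moeglin, Acta Math. 216 (2016), Part 2 §1.3.
* [Jacobson] N. Jacobson, *Lectures in Abstract Algebra II: Linear Algebra* (1953), Ch. V §7.
* [Hall2015] B. Hall, *Lie Groups, Lie Algebras, and Representations*, 2nd ed., GTM 222 (2015), Prop. 2.3–2.4.
* [Rudin1980] W. Rudin, *Function Theory in the Unit Ball of ℂⁿ* (1980), §1.3 (real and complex differentials; inverse function theorem).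
-/

set_option autoImplicit false

noncomputable section

open Matrix NumberField NumberField.InfinitePlace
open scoped Matrix ComplexConjugate ComplexOrder
open Literature.NumberTheory.Automorphic Literature.NumberTheory.Automorphic.UnitaryGroup
open Literature.NumberTheory.Automorphic.UnitaryCurveForms

namespace Literature.AlgebraicGeometry.ShimuraVarieties.UnitaryCurveCone

variable {E : Type} [Field E] {J : Matrix (Fin 2) (Fin 2) E} {w₁ : {w : InfinitePlace E // IsComplex w}}

/-! ### §1. Frame matrices -/

section FrameMatrices

variable (𝔣 : ConeFrame E J w₁)

/-- **Matrices are determined by their action on the frame** `(t₀, v₀)`. [cite: Jacobson, Ch. V §7 pp. 150–151] -/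
theorem eq_of_mulVec_frame_eq (hJ : (J.map w₁.1.embedding).IsHermitian) {A B : Matrix (Fin 2) (Fin 2) ℂ}
    (hv : A *ᵥ 𝔣.v₀ = B *ᵥ 𝔣.v₀) (ht : A *ᵥ 𝔣.t₀ = B *ᵥ 𝔣.t₀) : A = B := by
  have hw : ∀ w : Fin 2 → ℂ, A *ᵥ w = B *ᵥ w := fun w => by
    obtain ⟨a, d, rfl⟩ := exists_frame_coords 𝔣 hJ w
    rw [mulVec_add, mulVec_add, mulVec_smul, mulVec_smul, mulVec_smul, mulVec_smul, hv, ht]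
  ext i j
  have h := congrFun (hw (Pi.single j 1)) i
  rwa [Matrix.mulVec_single_one, Matrix.mulVec_single_one] at h

/-- `(a ⊗ b) v = (b · v) a` for the outer product `vecMulVec a b` (Mathlib states `vecMulVec_mulVec` with an opposite-ring scalar).
[folklore] -/
private theorem vecMulVec_mulVec_eq_smul' {m : Type} [Fintype m] (a b v : m → ℂ) : vecMulVec a b *ᵥ v = (b ⬝ᵥ v) • a := by
  ext i
  simp [vecMulVec_apply, mulVec, dotProduct, Finset.mul_sum, mul_comm, mul_left_comm]

/-- **Matrices with prescribed frame action exist**: for any `α β α' β'` there is `Y ∈ M₂(ℂ)` with `Y v₀ = α t₀ + β v₀` and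
`Y t₀ = α' t₀ + β' v₀` (rank-one matrices `x ⊗ (yᴴ Jw)` read through the hermitian form). [cite: Jacobson, Ch. V §7 pp. 150–151] -/
theorem exists_matrix_of_frame_action (hJ : (J.map w₁.1.embedding).IsHermitian) (α β α' β' : ℂ) :
    ∃ Y : Matrix (Fin 2) (Fin 2) ℂ, Y *ᵥ 𝔣.v₀ = α • 𝔣.t₀ + β • 𝔣.v₀ ∧ Y *ᵥ 𝔣.t₀ = α' • 𝔣.t₀ + β' • 𝔣.v₀ := by
  set Jw := J.map w₁.1.embedding with hJw
  set ν : ℂ := star 𝔣.v₀ ⬝ᵥ (Jw *ᵥ 𝔣.v₀) with hν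
  set π : ℂ := star 𝔣.t₀ ⬝ᵥ (Jw *ᵥ 𝔣.t₀) with hπ
  have hν0 : ν ≠ 0 := form_v₀_ne_zero 𝔣
  have hπ0 : π ≠ 0 := form_t₀_ne_zero 𝔣
  refine ⟨ν⁻¹ • vecMulVec (α • 𝔣.t₀ + β • 𝔣.v₀) (star 𝔣.v₀ ᵥ* Jw) + π⁻¹ • vecMulVec (α' • 𝔣.t₀ + β' • 𝔣.v₀) (star 𝔣.t₀ ᵥ* Jw),
    ?_, ?_⟩
  · rw [add_mulVec, smul_mulVec, smul_mulVec, vecMulVec_mulVec_eq_smul', vecMulVec_mulVec_eq_smul', ← dotProduct_mulVec,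
      ← dotProduct_mulVec, ← hν, 𝔣.orth, zero_smul, smul_zero, add_zero, smul_smul, inv_mul_cancel₀ hν0, one_smul]
  · rw [add_mulVec, smul_mulVec, smul_mulVec, vecMulVec_mulVec_eq_smul', vecMulVec_mulVec_eq_smul', ← dotProduct_mulVec,
      ← dotProduct_mulVec, form_v₀_t₀ 𝔣 hJ, ← hπ, zero_smul, smul_zero, zero_add, smul_smul, inv_mul_cancel₀ hπ0, one_smul]

/-- Frame action of `1 + ζ • Y`: if `Y v₀ = k v₀`, `Y t₀ = a t₀ + d v₀` then `(1 + ζ Y) v₀ = (1 + ζ k) v₀`,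
`(1 + ζ Y) t₀ = (1 + ζ a) t₀ + (ζ d) v₀`. [cite: Borel1997, §5.13–§5.14] -/
theorem frame_coords_one_add_smul {Y : Matrix (Fin 2) (Fin 2) ℂ} {k a d : ℂ} (ζ : ℂ) (hYv : Y *ᵥ 𝔣.v₀ = k • 𝔣.v₀)
    (hYt : Y *ᵥ 𝔣.t₀ = a • 𝔣.t₀ + d • 𝔣.v₀) :
    (1 + ζ • Y) *ᵥ 𝔣.v₀ = (1 + ζ * k) • 𝔣.v₀ ∧ (1 + ζ • Y) *ᵥ 𝔣.t₀ = (1 + ζ * a) • 𝔣.t₀ + (ζ * d) • 𝔣.v₀ := by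
  refine ⟨?_, ?_⟩
  · rw [add_mulVec, one_mulVec, smul_mulVec, hYv, smul_smul, add_smul, one_smul]
  · rw [add_mulVec, one_mulVec, smul_mulVec, hYt, smul_add, smul_smul, smul_smul, add_smul, one_smul, add_assoc]

end FrameMatrices

/-! ### §2. The cone law along lines in `Stab(ℂ v₀)` -/

section Analysis

open scoped Matrix.Norms.Operator
open _root_.Topology

variable (𝔣 : ConeFrame E J w₁)

/-- An `ℝ`-linear functional on a complex normed space that commutes with `I` is `ℂ`-linear. [folklore] -/
private theorem exists_restrictScalars_eq {V : Type*} [NormedAddCommGroup V] [NormedSpace ℂ V] (D : V →L[ℝ] ℂ)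
    (hD : ∀ v, D (Complex.I • v) = Complex.I * D v) : ∃ D' : V →L[ℂ] ℂ, D'.restrictScalars ℝ = D := by
  refine ⟨{ toFun := D, map_add' := D.map_add, map_smul' := fun c v => ?_, cont := D.continuous }, rfl⟩
  rw [RingHom.id_apply, smul_eq_mul]
  conv_lhs => rw [← Complex.re_add_im c]
  rw [add_smul, mul_smul, Complex.coe_smul, Complex.coe_smul, D.map_add, D.map_smul, D.map_smul, hD,
    Complex.real_smul, Complex.real_smul]
  conv_rhs => rw [← Complex.re_add_im c]
  ring

/-- **(a) THE LAW ALONG A LINE IN `Stab(ℂ v₀)`**: for `u ∈ U` and `Y` with frame coordinates `(k, a, d)`, the function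
`ζ ↦ Φ (u (1 + ζ Y))` is, near `0`, the rational function `(1 + ζ a)(1 + ζ k)⁻¹ Φ(u)`; in particular it has complex derivative
`(a − k) Φ(u)` at `0` (the infinitesimal cotangent character `dλ(Y) = a − k`). [cite: Borel1997, §5.13–§5.14] -/
theorem hasDerivAt_law_line (Φ : Matrix (Fin 2) (Fin 2) ℂ → ℂ)
    (hlaw : ∀ (g b : Matrix (Fin 2) (Fin 2) ℂ) (a k d : ℂ), IsUnit g → g *ᵥ 𝔣.v₀ ∈ negCone (J.map w₁.1.embedding) → k ≠ 0 →
      b *ᵥ 𝔣.v₀ = k • 𝔣.v₀ → b *ᵥ 𝔣.t₀ = a • 𝔣.t₀ + d • 𝔣.v₀ → Φ (g * b) = (a * k⁻¹) * Φ g)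
    (u : archLocal E 2 J w₁) {Y : Matrix (Fin 2) (Fin 2) ℂ} {k a d : ℂ} (hYv : Y *ᵥ 𝔣.v₀ = k • 𝔣.v₀)
    (hYt : Y *ᵥ 𝔣.t₀ = a • 𝔣.t₀ + d • 𝔣.v₀) :
    HasDerivAt (fun ζ : ℂ => Φ (((u : GL (Fin 2) ℂ) : Matrix (Fin 2) (Fin 2) ℂ) * (1 + ζ • Y)))
      ((a - k) * Φ ((u : GL (Fin 2) ℂ) : Matrix (Fin 2) (Fin 2) ℂ)) 0 := by
  set uM : Matrix (Fin 2) (Fin 2) ℂ := ((u : GL (Fin 2) ℂ) : Matrix (Fin 2) (Fin 2) ℂ) with huM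
  obtain ⟨hu, huv⟩ := isUnit_and_mulVec_mem_negCone 𝔣 u
  -- the rational function and its derivative at `0`
  have hrat : HasDerivAt (fun ζ : ℂ => (1 + ζ * a) * (1 + ζ * k)⁻¹ * Φ uM) ((a - k) * Φ uM) 0 := by
    have h1 : HasDerivAt (fun ζ : ℂ => 1 + ζ * a) a 0 := by
      simpa using (hasDerivAt_id (0 : ℂ)).mul_const a |>.const_add 1
    have h2 : HasDerivAt (fun ζ : ℂ => 1 + ζ * k) k 0 := by
      simpa using (hasDerivAt_id (0 : ℂ)).mul_const k |>.const_add 1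
    have h2' : HasDerivAt (fun ζ : ℂ => (1 + ζ * k)⁻¹) (-k / (1 + 0 * k) ^ 2) 0 := h2.fun_inv (by simp)
    have h3 : HasDerivAt (fun ζ : ℂ => (1 + ζ * a) * (1 + ζ * k)⁻¹ * Φ uM)
        ((a * (1 + 0 * k)⁻¹ + (1 + 0 * a) * (-k / (1 + 0 * k) ^ 2)) * Φ uM) 0 := (h1.fun_mul h2').mul_const (Φ uM)
    refine h3.congr_deriv ?_
    ring
  -- agreement near `0`: `‖ζ k‖ < 1 ⇒ 1 + ζ k ≠ 0`
  have hev : (fun ζ : ℂ => Φ (uM * (1 + ζ • Y))) =ᶠ[𝓝 0] fun ζ : ℂ => (1 + ζ * a) * (1 + ζ * k)⁻¹ * Φ uM := by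
    have hopen : ∀ᶠ ζ in 𝓝 (0 : ℂ), 1 + ζ * k ≠ 0 := by
      have hc : ContinuousAt (fun ζ : ℂ => 1 + ζ * k) 0 := by fun_prop
      exact hc.eventually_ne (by simp)
    filter_upwards [hopen] with ζ hζ
    obtain ⟨hbv, hbt⟩ := frame_coords_one_add_smul 𝔣 ζ hYv hYt
    rw [hlaw uM (1 + ζ • Y) (1 + ζ * a) (1 + ζ * k) (ζ * d) hu huv hζ hbv hbt]
  exact hrat.congr_of_eventuallyEq hev

/-- **(a′) the directional derivatives of `Φ` at `u` along `u · Stab(ℂ v₀)`**: if `g ↦ Φ g` (read on `Fin 2 → Fin 2 → ℂ`) has real Fréchet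
derivative `D` at `u ∈ U`, then for `Y` with frame coordinates `(k, a, d)` and every `ζ ∈ ℂ`,
`D (ζ • u Y) = ζ (a − k) Φ(u)` — in particular `D` is `ℂ`-LINEAR on the real subspace `u · Stab(ℂ v₀)`. [cite: Borel1997, §5.13–§5.14] -/
theorem fderiv_apply_smul_stab (Φ : Matrix (Fin 2) (Fin 2) ℂ → ℂ)
    (hlaw : ∀ (g b : Matrix (Fin 2) (Fin 2) ℂ) (a k d : ℂ), IsUnit g → g *ᵥ 𝔣.v₀ ∈ negCone (J.map w₁.1.embedding) → k ≠ 0 →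
      b *ᵥ 𝔣.v₀ = k • 𝔣.v₀ → b *ᵥ 𝔣.t₀ = a • 𝔣.t₀ + d • 𝔣.v₀ → Φ (g * b) = (a * k⁻¹) * Φ g)
    (u : archLocal E 2 J w₁) {D : (Fin 2 → Fin 2 → ℂ) →L[ℝ] ℂ}
    (hD : HasFDerivAt (fun g : Fin 2 → Fin 2 → ℂ => Φ (Matrix.of g)) D
      (Matrix.of.symm ((u : GL (Fin 2) ℂ) : Matrix (Fin 2) (Fin 2) ℂ)))
    {Y : Matrix (Fin 2) (Fin 2) ℂ} {k a d : ℂ} (hYv : Y *ᵥ 𝔣.v₀ = k • 𝔣.v₀) (hYt : Y *ᵥ 𝔣.t₀ = a • 𝔣.t₀ + d • 𝔣.v₀) (ζ : ℂ) :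
    D (ζ • Matrix.of.symm (((u : GL (Fin 2) ℂ) : Matrix (Fin 2) (Fin 2) ℂ) * Y)) =
      ζ * ((a - k) * Φ ((u : GL (Fin 2) ℂ) : Matrix (Fin 2) (Fin 2) ℂ)) := by
  set uM : Matrix (Fin 2) (Fin 2) ℂ := ((u : GL (Fin 2) ℂ) : Matrix (Fin 2) (Fin 2) ℂ) with huM
  set w : Fin 2 → Fin 2 → ℂ := Matrix.of.symm (uM * Y) with hw
  -- the line `ζ ↦ u + ζ • w` and the chain rule
  have hline : HasFDerivAt (fun ζ : ℂ => Matrix.of.symm uM + ζ • w) ((ContinuousLinearMap.id ℝ ℂ).smulRight w) 0 :=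
    ((((ContinuousLinearMap.id ℝ ℂ).smulRight w).hasFDerivAt).const_add (Matrix.of.symm uM)).congr_of_eventuallyEq
      (Filter.Eventually.of_forall fun ζ => by
        simp only [ContinuousLinearMap.smulRight_apply, ContinuousLinearMap.id_apply])
  have h0 : Matrix.of.symm uM + (0 : ℂ) • w = Matrix.of.symm uM := by rw [zero_smul, add_zero]
  have hD' : HasFDerivAt (fun g : Fin 2 → Fin 2 → ℂ => Φ (Matrix.of g)) D (Matrix.of.symm uM + (0 : ℂ) • w) := by
    rw [h0]; exact hD
  have hcomp := hD'.comp (0 : ℂ) hline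
  -- the composite IS the law-line function
  have hfun : ((fun g : Fin 2 → Fin 2 → ℂ => Φ (Matrix.of g)) ∘ fun ζ : ℂ => Matrix.of.symm uM + ζ • w) =
      fun ζ : ℂ => Φ (uM * (1 + ζ • Y)) := by
    funext ζ
    simp only [Function.comp_apply, hw]
    congr 1
    rw [Matrix.mul_add, Matrix.mul_one, Matrix.mul_smul]
    rfl
  rw [hfun] at hcomp
  -- compare with the complex derivative of the law line
  have hlawline := (hasDerivAt_law_line 𝔣 Φ hlaw u hYv hYt).hasFDerivAt.restrictScalars ℝ
  have huniq := hcomp.unique hlawline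
  have happ := congrArg (fun T : ℂ →L[ℝ] ℂ => T ζ) huniq
  simp only [ContinuousLinearMap.coe_comp, Function.comp_apply, ContinuousLinearMap.smulRight_apply,
    ContinuousLinearMap.id_apply, ContinuousLinearMap.coe_restrictScalars'] at happ
  rw [happ, ContinuousLinearMap.toSpanSingleton_apply, smul_eq_mul]

end Analysis

/-! ### §3. The cone chart: real differentiability from the probe (inverse function theorem) -/

section IFT

open scoped Matrix.Norms.Operator
open _root_.Topology Filter

variable (𝔣 : ConeFrame E J w₁)

/-- **REAL DIFFERENTIABILITY ON THE CONE FROM PROBE DIFFERENTIABILITY ON THE GROUP (inverse function theorem).**  Let `Φ` obey the cone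
law, let `X` be a `𝔭`-probe of the frame (`X z ∈ 𝔲(Jw)`, `X z · v₀ = z t₀`, `X z · t₀ ∈ ℂ v₀`) and `u ∈ U`.  If the probe `z ↦ Φ(u · exp (X z))` is
real-differentiable at `0`, then `g ↦ Φ g` (read on `ℂ^{2×2}`) is real-Fréchet-differentiable at `u`.  PROOF: the map
`F(z, k, a, d) = u · exp(X z) · (1 + k P_v + a P_t + d N)` (`P_v, P_t, N` the frame matrices `v₀ ↦ v₀`, `t₀ ↦ t₀`, `t₀ ↦ v₀`) is smooth with
BIJECTIVE differential `(ζ, κ, α, δ) ↦ u (X ζ + κ P_v + α P_t + δ N)` at `0` (the `ℂ`-linear half of the probe spans the tangent line of the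
disc, `Stab(ℂ v₀)` the rest), hence a local diffeomorphism at `0` (Mathlib `HasStrictFDerivAt.localInverse`); by the cone law
`Φ ∘ F = (1 + a)(1 + k)⁻¹ · Φ(u exp(X z))` near `0`, a product of functions differentiable at `0`. [cite: Borel1997, §5.13–§5.14]
[cite: Rudin1980, §1.3 (inverse function theorem in several variables)] -/
theorem differentiableAt_real_of_coneLaw_of_probe (hJ : (J.map w₁.1.embedding).IsHermitian)
    (X : ℂ →ₗ[ℝ] Matrix (Fin 2) (Fin 2) ℂ) (hXu : ∀ z, (X z)ᴴ * J.map w₁.1.embedding + J.map w₁.1.embedding * X z = 0)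
    (hXv : ∀ z, X z *ᵥ 𝔣.v₀ = z • 𝔣.t₀) (hXt : ∀ z, ∃ c : ℂ, X z *ᵥ 𝔣.t₀ = c • 𝔣.v₀)
    (Φ : Matrix (Fin 2) (Fin 2) ℂ → ℂ)
    (hlaw : ∀ (g b : Matrix (Fin 2) (Fin 2) ℂ) (a k d : ℂ), IsUnit g → g *ᵥ 𝔣.v₀ ∈ negCone (J.map w₁.1.embedding) → k ≠ 0 →
      b *ᵥ 𝔣.v₀ = k • 𝔣.v₀ → b *ᵥ 𝔣.t₀ = a • 𝔣.t₀ + d • 𝔣.v₀ → Φ (g * b) = (a * k⁻¹) * Φ g)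
    (u : archLocal E 2 J w₁)
    (hψ : DifferentiableAt ℝ (fun z : ℂ => Φ (((u : GL (Fin 2) ℂ) : Matrix (Fin 2) (Fin 2) ℂ) * NormedSpace.exp (X z))) 0) :
    DifferentiableAt ℝ (fun g : Fin 2 → Fin 2 → ℂ => Φ (Matrix.of g))
      (Matrix.of.symm ((u : GL (Fin 2) ℂ) : Matrix (Fin 2) (Fin 2) ℂ)) := by
  set uM : Matrix (Fin 2) (Fin 2) ℂ := ((u : GL (Fin 2) ℂ) : Matrix (Fin 2) (Fin 2) ℂ) with huM
  have hu : IsUnit uM := (isUnit_and_mulVec_mem_negCone 𝔣 u).1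
  obtain ⟨γ, hγ⟩ := exists_expFamily_archLocal 𝔣 hJ X hXu
  have hX0 : X 0 = 0 := map_zero X
  -- frame matrices
  obtain ⟨Pv, hPvv, hPvt⟩ := exists_matrix_of_frame_action 𝔣 hJ 0 1 0 0
  obtain ⟨Pt, hPtv, hPtt⟩ := exists_matrix_of_frame_action 𝔣 hJ 0 0 1 0
  obtain ⟨Nm, hNmv, hNmt⟩ := exists_matrix_of_frame_action 𝔣 hJ 0 0 0 1
  simp only [zero_smul, one_smul, zero_add, add_zero] at hPvv hPvt hPtv hPtt hNmv hNmt
  -- the continuous linear maps of the construction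
  let XL : ℂ →L[ℝ] Matrix (Fin 2) (Fin 2) ℂ := LinearMap.toContinuousLinearMap X
  have hXL : ∀ z, XL z = X z := fun z => rfl
  let e0 : (Fin 4 → ℂ) →L[ℝ] ℂ := ContinuousLinearMap.proj (R := ℝ) (φ := fun _ : Fin 4 => ℂ) 0
  let L : (Fin 4 → ℂ) →L[ℝ] Matrix (Fin 2) (Fin 2) ℂ :=
    (ContinuousLinearMap.proj (R := ℝ) (φ := fun _ : Fin 4 => ℂ) 1).smulRight Pv +
      (ContinuousLinearMap.proj (R := ℝ) (φ := fun _ : Fin 4 => ℂ) 2).smulRight Pt +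
      (ContinuousLinearMap.proj (R := ℝ) (φ := fun _ : Fin 4 => ℂ) 3).smulRight Nm
  have hL : ∀ e : Fin 4 → ℂ, L e = e 1 • Pv + e 2 • Pt + e 3 • Nm := fun e => rfl
  have hLv : ∀ e : Fin 4 → ℂ, (1 + L e) *ᵥ 𝔣.v₀ = (1 + e 1) • 𝔣.v₀ := fun e => by
    rw [hL]
    simp only [add_mulVec, one_mulVec, smul_mulVec, hPvv, hPtv, hNmv, smul_zero, add_zero]
    module
  have hLt : ∀ e : Fin 4 → ℂ, (1 + L e) *ᵥ 𝔣.t₀ = (1 + e 2) • 𝔣.t₀ + e 3 • 𝔣.v₀ := fun e => by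
    rw [hL]
    simp only [add_mulVec, one_mulVec, smul_mulVec, hPvt, hPtt, hNmt, smul_zero, zero_add]
    module
  let idL : Matrix (Fin 2) (Fin 2) ℂ →L[ℝ] (Fin 2 → Fin 2 → ℂ) :=
    LinearMap.toContinuousLinearMap (Matrix.ofLinearEquiv ℝ).symm.toLinearMap
  have hidL : ∀ A, idL A = Matrix.of.symm A := fun A => rfl
  -- the chart `F` and its smoothness
  let Ft : (Fin 4 → ℂ) → Matrix (Fin 2) (Fin 2) ℂ := fun e => uM * NormedSpace.exp (XL (e0 e)) * (1 + L e)
  let F : (Fin 4 → ℂ) → (Fin 2 → Fin 2 → ℂ) := fun e => idL (Ft e)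
  have hexp : ContDiff ℝ ⊤ (NormedSpace.exp : Matrix (Fin 2) (Fin 2) ℂ → Matrix (Fin 2) (Fin 2) ℂ) :=
    contDiff_iff_contDiffAt.2 fun A => (NormedSpace.exp_analytic (𝕂 := ℝ) A).contDiffAt.of_le le_top
  have hFt : ContDiff ℝ ⊤ Ft :=
    (contDiff_const.mul (hexp.comp (XL.contDiff.comp e0.contDiff))).mul (contDiff_const.add L.contDiff)
  have hF : ContDiff ℝ ⊤ F := idL.contDiff.comp hFt
  -- the derivative of `F` at `0`
  have h1 : HasFDerivAt (fun e : Fin 4 → ℂ => NormedSpace.exp (XL (e0 e))) (XL.comp e0) 0 := by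
    have hpt : XL (e0 0) = 0 := by
      change X ((0 : Fin 4 → ℂ) 0) = 0
      rw [Pi.zero_apply, hX0]
    have hexp0 : HasFDerivAt (NormedSpace.exp : Matrix (Fin 2) (Fin 2) ℂ → Matrix (Fin 2) (Fin 2) ℂ)
        (1 : Matrix (Fin 2) (Fin 2) ℂ →L[ℝ] Matrix (Fin 2) (Fin 2) ℂ) (XL (e0 0)) := by
      rw [hpt]; exact hasFDerivAt_exp_zero
    have h := hexp0.comp (0 : Fin 4 → ℂ) (XL.comp e0).hasFDerivAt
    exact h.congr_fderiv (by ext1 e; rfl)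
  have h2 : HasFDerivAt (fun e : Fin 4 → ℂ => uM * NormedSpace.exp (XL (e0 e))) (uM • XL.comp e0) 0 := h1.const_mul uM
  have h3 : HasFDerivAt (fun e : Fin 4 → ℂ => (1 : Matrix (Fin 2) (Fin 2) ℂ) + L e) L 0 := L.hasFDerivAt.const_add 1
  have h4 := h2.mul' h3
  have hval1 : uM * NormedSpace.exp (XL (e0 (0 : Fin 4 → ℂ))) = uM := by
    change uM * NormedSpace.exp (X ((0 : Fin 4 → ℂ) 0)) = uM
    rw [Pi.zero_apply, hX0, NormedSpace.exp_zero, Matrix.mul_one]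
  have hval2 : (1 : Matrix (Fin 2) (Fin 2) ℂ) + L 0 = 1 := by rw [map_zero, add_zero]
  rw [hval1, hval2] at h4
  set F't : (Fin 4 → ℂ) →L[ℝ] Matrix (Fin 2) (Fin 2) ℂ :=
    uM • L + MulOpposite.op (1 : Matrix (Fin 2) (Fin 2) ℂ) • (uM • XL.comp e0) with hF't
  have hF'tapply : ∀ e : Fin 4 → ℂ, F't e = uM * (X (e 0) + (e 1 • Pv + e 2 • Pt + e 3 • Nm)) := fun e => by
    have h : F't e = uM * L e + uM * XL (e0 e) * 1 := rfl
    rw [h, hL, hXL, Matrix.mul_one, show e0 e = e 0 from rfl]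
    simp only [Matrix.mul_add]
    abel
  have hF' : HasFDerivAt F (idL.comp F't) 0 := idL.hasFDerivAt.comp (0 : Fin 4 → ℂ) h4
  set F' : (Fin 4 → ℂ) →L[ℝ] (Fin 2 → Fin 2 → ℂ) := idL.comp F't with hF'def
  have hF'apply : ∀ e : Fin 4 → ℂ, F' e = Matrix.of.symm (uM * (X (e 0) + (e 1 • Pv + e 2 • Pt + e 3 • Nm))) := fun e => by
    rw [hF'def, ContinuousLinearMap.comp_apply, hidL, hF'tapply]
  -- `F'` is injective
  have hinj : Function.Injective F' := by
    intro e e' h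
    rw [hF'apply, hF'apply] at h
    have h' : uM * (X (e 0) + (e 1 • Pv + e 2 • Pt + e 3 • Nm)) = uM * (X (e' 0) + (e' 1 • Pv + e' 2 • Pt + e' 3 • Nm)) :=
      Matrix.of.symm.injective h
    have h'' := hu.mul_left_cancel h'
    have hv := congrArg (fun A : Matrix (Fin 2) (Fin 2) ℂ => A *ᵥ 𝔣.v₀) h''
    simp only [add_mulVec, smul_mulVec, hXv, hPvv, hPtv, hNmv, smul_zero, add_zero] at hv
    obtain ⟨h0, h1'⟩ := frame_coords_unique 𝔣 hJ hv
    rw [h0] at h''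
    have hL' := add_left_cancel h''
    have ht := congrArg (fun A : Matrix (Fin 2) (Fin 2) ℂ => A *ᵥ 𝔣.t₀) hL'
    simp only [add_mulVec, smul_mulVec, hPvt, hPtt, hNmt, smul_zero, zero_add] at ht
    obtain ⟨h2', h3'⟩ := frame_coords_unique 𝔣 hJ ht
    funext i
    fin_cases i
    · exact h0
    · exact h1'
    · exact h2'
    · exact h3'
  -- `F'` is surjective
  have hsurj : Function.Surjective F' := by
    intro W
    set V : Matrix (Fin 2) (Fin 2) ℂ := (((u : GL (Fin 2) ℂ)⁻¹ : GL (Fin 2) ℂ) : Matrix (Fin 2) (Fin 2) ℂ) * Matrix.of W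
      with hV
    obtain ⟨α, β, hVv⟩ := exists_frame_coords 𝔣 hJ (V *ᵥ 𝔣.v₀)
    obtain ⟨α', β', hVt⟩ := exists_frame_coords 𝔣 hJ (V *ᵥ 𝔣.t₀)
    obtain ⟨c, hc⟩ := hXt α
    refine ⟨![α, β, α', β' - c], ?_⟩
    rw [hF'apply]
    have hsum : X α + (β • Pv + α' • Pt + (β' - c) • Nm) = V := by
      refine eq_of_mulVec_frame_eq 𝔣 hJ ?_ ?_
      · rw [add_mulVec, add_mulVec, add_mulVec, smul_mulVec, smul_mulVec, smul_mulVec, hXv, hPvv, hPtv, hNmv, hVv,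
          smul_zero, smul_zero, add_zero, add_zero]
      · rw [add_mulVec, add_mulVec, add_mulVec, smul_mulVec, smul_mulVec, smul_mulVec, hc, hPvt, hPtt, hNmt, hVt,
          smul_zero, zero_add]
        module
    simp only [Matrix.cons_val_zero, Matrix.cons_val_one, Matrix.cons_val]
    rw [hsum, hV, ← Matrix.mul_assoc, ← Units.val_mul, mul_inv_cancel, Units.val_one, Matrix.one_mul]
    rfl
  -- the strict derivative as an equivalence, and the local inverse
  let Feq : (Fin 4 → ℂ) ≃L[ℝ] (Fin 2 → Fin 2 → ℂ) :=
    (LinearEquiv.ofBijective (F' : (Fin 4 → ℂ) →ₗ[ℝ] (Fin 2 → Fin 2 → ℂ)) ⟨hinj, hsurj⟩).toContinuousLinearEquiv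
  have hFeq : (Feq : (Fin 4 → ℂ) →L[ℝ] (Fin 2 → Fin 2 → ℂ)) = F' := by
    ext1 e; rfl
  have hstrict : HasStrictFDerivAt F (Feq : (Fin 4 → ℂ) →L[ℝ] (Fin 2 → Fin 2 → ℂ)) 0 := by
    rw [hFeq, ← hF'.fderiv]
    exact hF.contDiffAt.hasStrictFDerivAt (by simp)
  have hF0 : F 0 = Matrix.of.symm uM := by
    change idL (uM * NormedSpace.exp (X ((0 : Fin 4 → ℂ) 0)) * (1 + L 0)) = _
    rw [Pi.zero_apply, hX0, NormedSpace.exp_zero, Matrix.mul_one, map_zero, add_zero, Matrix.mul_one, hidL]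
  set loc := hstrict.localInverse F Feq 0 with hloc
  have hright : ∀ᶠ m in 𝓝 (F 0), F (loc m) = m := hstrict.eventually_right_inverse
  have hloc0 : loc (F 0) = 0 := hstrict.localInverse_apply_image
  have hlocd : HasFDerivAt loc (Feq.symm : (Fin 2 → Fin 2 → ℂ) →L[ℝ] (Fin 4 → ℂ)) (F 0) := hstrict.to_localInverse.hasFDerivAt
  have htend : Tendsto loc (𝓝 (F 0)) (𝓝 0) := hstrict.localInverse_tendsto
  -- the model function `G`
  let G : (Fin 4 → ℂ) → ℂ := fun e => (1 + e 2) * (1 + e 1)⁻¹ * Φ (uM * NormedSpace.exp (X (e 0)))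
  have hG : DifferentiableAt ℝ G 0 := by
    have ha : DifferentiableAt ℝ (fun e : Fin 4 → ℂ => (1 : ℂ) + e 2) 0 := by fun_prop
    have hk : DifferentiableAt ℝ (fun e : Fin 4 → ℂ => ((1 : ℂ) + e 1)⁻¹) 0 := by
      have h : DifferentiableAt ℂ (fun e : Fin 4 → ℂ => ((1 : ℂ) + e 1)⁻¹) 0 := by
        refine DifferentiableAt.inv (by fun_prop) ?_
        simp
      exact h.restrictScalars ℝ
    have hp : DifferentiableAt ℝ (fun e : Fin 4 → ℂ => Φ (uM * NormedSpace.exp (X (e 0)))) 0 := by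
      have he : DifferentiableAt ℝ (fun e : Fin 4 → ℂ => e 0) 0 := e0.differentiableAt
      have hψ' : DifferentiableAt ℝ (fun z : ℂ => Φ (uM * NormedSpace.exp (X z))) ((fun e : Fin 4 → ℂ => e 0) 0) := by
        simpa using hψ
      have hp' := DifferentiableAt.comp (0 : Fin 4 → ℂ) hψ' he
      exact hp'
    exact (ha.mul hk).mul hp
  -- `Φ` agrees with `G ∘ loc` near `u`
  have hev : (fun g : Fin 2 → Fin 2 → ℂ => Φ (Matrix.of g)) =ᶠ[𝓝 (F 0)] (G ∘ loc) := by
    have hne : ∀ᶠ m in 𝓝 (F 0), (1 : ℂ) + loc m 1 ≠ 0 := by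
      have hopen : IsOpen {e : Fin 4 → ℂ | (1 : ℂ) + e 1 ≠ 0} := isOpen_ne_fun (by fun_prop) continuous_const
      have hmem : {e : Fin 4 → ℂ | (1 : ℂ) + e 1 ≠ 0} ∈ 𝓝 (0 : Fin 4 → ℂ) := hopen.mem_nhds (by simp)
      exact htend.eventually_mem hmem
    filter_upwards [hright, hne] with m hm h1
    simp only [Function.comp_apply]
    have hm' : Matrix.of m = uM * NormedSpace.exp (X (loc m 0)) * (1 + L (loc m)) := by
      conv_lhs => rw [← hm]
      rfl
    have hg : IsUnit (uM * NormedSpace.exp (X (loc m 0))) ∧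
        (uM * NormedSpace.exp (X (loc m 0))) *ᵥ 𝔣.v₀ ∈ negCone (J.map w₁.1.embedding) := by
      have h := isUnit_and_mulVec_mem_negCone 𝔣 (u * γ (loc m 0))
      rwa [Subgroup.coe_mul, Units.val_mul, hγ] at h
    rw [hm', hlaw _ _ (1 + loc m 2) (1 + loc m 1) (loc m 3) hg.1 hg.2 h1 (hLv _) (hLt _)]
  -- conclusion
  have hcomp : DifferentiableAt ℝ (G ∘ loc) (F 0) := by
    have hG' : DifferentiableAt ℝ G (loc (F 0)) := by rw [hloc0]; exact hG
    exact hG'.comp (F 0) hlocd.differentiableAt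
  rw [← hF0]
  exact hev.differentiableAt_iff.2 hcomp

end IFT

end Literature.AlgebraicGeometry.ShimuraVarieties.UnitaryCurveCone

end
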